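import Literature.Barriers.PneNP.TardosFunction
import Literature.Computability.Complexity.GraphEncodings
import HarnessLib

/-!
# The complement code of an edge vector (input conventions of Tardos's reduction)

Bookkeeping shared by the reduction `GLS1981_thetaApprox_unary_FP ⟹ Tardos1988_thetaFn_polysize`
(`TardosFunctionFP.lean`): Tardos's function `φ(X) = ϑ(X̄)` (Tardos 1988, p. 142) feeds the
approximation routine for `ϑ` the COMPLEMENT of the input graph, in the tree's graph encoding
(`Literature.Computability.Complexity.encodingGraphFin`: the `n²` row-major adjacency bits).
For an edge vector `x : KEdge n → Bool` (graph `G_x = cliqueGraph x`) this file provides, all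
PROVED:

* `complCode x` — the code of `Ḡ_x = (cliqueGraph x)ᶜ`, and `complBits x` — the same `n²` bits as
  an explicit Boolean function of `x` (`complCode_eq_ofFn`), with its `B₂`-program of `n²` gates
  (`cktSize_complBits`: a constant on the diagonal, a negated input off it) — the input layer put
  in front of the `P/poly` circuits;
* the counting identity `count_true_complCode`: `#₁(complCode x) + 2 e(x) + n = n²` (ordered pairs
  = diagonal + twice the edges of `G_x` + twice the edges of `Ḡ_x`), through
  `card_offDiag_filter_eq_two_mul_edgeCount` (`#{(u,v) : u ≠ v, x_{uv} = 1} = 2 e(x)`); this is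
  what lets the program recover Tardos's correction term `e(X)·n⁻²` from the complement bits.

## References

* É. Tardos, Combinatorica 8 (1988) 141–142, p. 142 [Tardos1988] (held).
* S. Arora, B. Barak, *Computational Complexity* (2009), §0.1 (adjacency-matrix encoding)
  [AroraBarakCC2009].
-/

noncomputable section

namespace Literature.Barriers.PneNP

open Literature.Computability.Complexity _root_.Computability Finset

/-! ### The complement code of an edge vector -/

/-- The string fed to the approximation routine for the edge vector `x` of `G`: the code
(`encodingGraphFin`, row-major adjacency bits) of the COMPLEMENT `Ḡ = (cliqueGraph x)ᶜ`.
[cite: Tardos1988, p. 142] -/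
def complCode {n : ℕ} (x : KEdge n → Bool) : List Bool := (encodingGraphFin n).encode (cliqueGraph x)ᶜ

/-- The same bits as an explicit Boolean function of `x` (what the input layer of the circuit
computes): bit `(i, j)` is `0` on the diagonal and `¬x_{ij}` off it. [folklore] -/
def complBits {n : ℕ} (x : KEdge n → Bool) (k : Fin (n * n)) : Bool :=
  if h : (finProdFinEquiv.symm k).1 = (finProdFinEquiv.symm k).2 then false
  else !x ⟨s((finProdFinEquiv.symm k).1, (finProdFinEquiv.symm k).2), by simpa using h⟩

/-- Adjacency in the complement of the graph of an edge vector. [folklore] -/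
theorem compl_cliqueGraph_adj {n : ℕ} (x : KEdge n → Bool) (u v : Fin n) :
    (cliqueGraph x)ᶜ.Adj u v ↔ ∃ h : u ≠ v, x ⟨s(u, v), by simpa using h⟩ = false := by
  rw [SimpleGraph.compl_adj, cliqueGraph_adj]
  constructor
  · rintro ⟨hne, hx⟩
    refine ⟨hne, ?_⟩
    cases h' : x ⟨s(u, v), by simpa using hne⟩
    · rfl
    · exact absurd ⟨hne, h'⟩ hx
  · rintro ⟨hne, hx⟩
    refine ⟨hne, fun ⟨_, h'⟩ => ?_⟩
    rw [hx] at h'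
    exact Bool.false_ne_true h'

/-- The complement bits are the adjacency bits of the complement graph. [folklore] -/
theorem complBits_eq_true_iff {n : ℕ} (x : KEdge n → Bool) (k : Fin (n * n)) :
    complBits x k = true ↔
      (cliqueGraph x)ᶜ.Adj (finProdFinEquiv.symm k).1 (finProdFinEquiv.symm k).2 := by
  unfold complBits
  split_ifs with h
  · constructor
    · intro hft
      simp at hft
    · intro hadj
      obtain ⟨hne, -⟩ := (compl_cliqueGraph_adj x _ _).1 hadj
      exact absurd h hne
  · rw [compl_cliqueGraph_adj]
    constructor
    · intro hx
      exact ⟨h, by simpa using hx⟩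
    · rintro ⟨_, hx⟩
      simpa using hx

/-- The complement code is the list of the complement bits. [folklore] -/
theorem complCode_eq_ofFn {n : ℕ} (x : KEdge n → Bool) : complCode x = List.ofFn (complBits x) := by
  unfold complCode encodingGraphFin encodingBitVec
  simp only
  congr 1
  funext k
  rw [Bool.eq_iff_iff, complBits_eq_true_iff]
  exact @decide_eq_true_iff _ (_)

/-- The complement code has `n²` bits. [folklore] -/
@[simp] theorem length_complCode {n : ℕ} (x : KEdge n → Bool) : (complCode x).length = n * n := by
  rw [complCode_eq_ofFn, List.length_ofFn]

/-- The graph code of the complement is `⟨⟨n⟩₂, complCode x⟩`. [folklore] -/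
theorem encodingGraph_encode_compl {n : ℕ} (x : KEdge n → Bool) :
    encodingGraph.encode ⟨n, (cliqueGraph x)ᶜ⟩ = boolPair (encodeNat n) (complCode x) := rfl

/-- **The input layer**: the `n²` complement bits cost `n²` gates over `B₂` (a constant `0` on
the diagonal, a negated input off it). [folklore] -/
theorem cktSize_complBits (n : ℕ) :
    CktSize B2 (fun (x : KEdge n → Bool) k => complBits x k) (n * n) := by
  have h := CktSize.pi_const (B := B2) (κ := Fin (n * n)) (s := 1)
    (f := fun (x : KEdge n → Bool) k => complBits x k) fun k => ?_
  · simpa using h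
  · by_cases hk : (finProdFinEquiv.symm k).1 = (finProdFinEquiv.symm k).2
    · exact (cktSize_const (KEdge n) false).congr fun x _ => by
        unfold complBits; rw [dif_pos hk]
    · exact (cktSize_not (ι := KEdge n)
        ⟨s((finProdFinEquiv.symm k).1, (finProdFinEquiv.symm k).2), by simpa using hk⟩).congr
        fun x _ => by unfold complBits; rw [dif_neg hk]

/-! ### Counting: ones of the complement code versus edges -/

/-- `#₁` of a list of bits given by a function is the number of arguments sent to `1`.
[folklore] -/
theorem count_true_ofFn : ∀ {N : ℕ} (f : Fin N → Bool),
    (List.ofFn f).count true = ∑ k, if f k = true then 1 else 0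
  | 0, f => by simp
  | N + 1, f => by
    rw [List.ofFn_succ, List.count_cons, count_true_ofFn, Fin.sum_univ_succ]
    cases f 0 <;> simp [add_comm]

/-- Ordered off-diagonal pairs carrying an edge of `G_x` are twice the edges:
`#{(u,v) : u ≠ v, x_{uv} = 1} = 2 e(x)`. [folklore] -/
theorem card_offDiag_filter_eq_two_mul_edgeCount {n : ℕ} (x : KEdge n → Bool) :
    #((univ : Finset (Fin n)).offDiag.filter fun p =>
        ∃ h : p.1 ≠ p.2, x ⟨s(p.1, p.2), by simpa using h⟩ = true) = 2 * edgeCount x := by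
  classical
  set S := (univ : Finset (Fin n)).offDiag.filter fun p =>
    ∃ h : p.1 ≠ p.2, x ⟨s(p.1, p.2), by simpa using h⟩ = true with hS
  set T : Finset (Sym2 (Fin n)) := (univ.filter fun e : KEdge n => x e = true).map
    (Function.Embedding.subtype _) with hT
  have hmemS : ∀ p : Fin n × Fin n, p ∈ S ↔ ∃ h : p.1 ≠ p.2, x ⟨s(p.1, p.2), by simpa using h⟩ = true := by
    intro p
    simp only [hS, mem_filter, mem_offDiag, mem_univ, true_and, and_iff_right_iff_imp]
    exact fun ⟨h, _⟩ => h
  have hmemT : ∀ e : Sym2 (Fin n), e ∈ T ↔ ∃ h : e ∈ (⊤ : SimpleGraph (Fin n)).edgeSet, x ⟨e, h⟩ = true := by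
    intro e
    rw [hT, Finset.mem_map]
    constructor
    · rintro ⟨⟨e', he'⟩, hm, rfl⟩
      exact ⟨he', (mem_filter.1 hm).2⟩
    · rintro ⟨he, hx⟩
      exact ⟨⟨e, he⟩, mem_filter.2 ⟨mem_univ _, hx⟩, rfl⟩
  have hmap : ∀ p ∈ S, s(p.1, p.2) ∈ T := by
    intro p hp
    obtain ⟨hne, hx⟩ := (hmemS p).1 hp
    exact (hmemT _).2 ⟨by simpa using hne, hx⟩
  rw [card_eq_sum_card_fiberwise hmap]
  have hfib : ∀ e ∈ T, #(S.filter fun p => s(p.1, p.2) = e) = 2 := by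
    intro e he
    obtain ⟨he', hx⟩ := (hmemT e).1 he
    revert he' hx
    induction e using Sym2.ind with
    | _ a b =>
      intro he' hx
      have hab : a ≠ b := (SimpleGraph.mem_edgeSet _).1 he'
      have hset : (S.filter fun p => s(p.1, p.2) = s(a, b)) = {(a, b), (b, a)} := by
        ext ⟨u, v⟩
        simp only [mem_filter, hmemS, Sym2.eq_iff, mem_insert, mem_singleton, Prod.mk.injEq]
        constructor
        · rintro ⟨-, h⟩
          exact h
        · rintro (⟨rfl, rfl⟩ | ⟨rfl, rfl⟩)
          · exact ⟨⟨hab, hx⟩, Or.inl ⟨rfl, rfl⟩⟩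
          · refine ⟨⟨hab.symm, ?_⟩, Or.inr ⟨rfl, rfl⟩⟩
            have : (⟨s(u, v), by simpa using hab.symm⟩ : KEdge n) = ⟨s(v, u), he'⟩ :=
              Subtype.ext Sym2.eq_swap
            rw [this]; exact hx
      rw [hset, card_pair]
      intro h
      rw [Prod.mk.injEq] at h
      exact hab h.1
  rw [sum_congr rfl hfib, sum_const, smul_eq_mul, mul_comm, hT, card_map, edgeCount]

/-- **Ones of the complement code**: `#₁(complCode x) + 2 e(x) + n = n²` — the ordered pairs
split into the diagonal (`n`), the `2 e(x)` pairs on edges of `G_x` and the `#₁` pairs on edges of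
`Ḡ_x`. [folklore] -/
theorem count_true_complCode {n : ℕ} (x : KEdge n → Bool) :
    (complCode x).count true + 2 * edgeCount x + n = n * n := by
  classical
  -- ones = off-diagonal pairs NOT carrying an edge of `G_x`
  have h1 : (complCode x).count true = #((univ : Finset (Fin n)).offDiag.filter fun p =>
      ¬ ∃ h : p.1 ≠ p.2, x ⟨s(p.1, p.2), by simpa using h⟩ = true) := by
    rw [complCode_eq_ofFn, count_true_ofFn, card_filter,
      ← Equiv.sum_comp finProdFinEquiv (fun k => if complBits x k = true then 1 else 0)]
    have hsub : ∑ p ∈ (univ : Finset (Fin n)).offDiag,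
        (if complBits x (finProdFinEquiv p) = true then 1 else 0) =
        ∑ p, (if complBits x (finProdFinEquiv p) = true then 1 else 0) := by
      refine sum_subset (subset_univ _) fun p _ hp => ?_
      have hpp : p.1 = p.2 := by
        by_contra hne
        exact hp (mem_offDiag.2 ⟨mem_univ _, mem_univ _, hne⟩)
      have hb : complBits x (finProdFinEquiv p) = false := by
        unfold complBits
        rw [dif_pos (by rw [Equiv.symm_apply_apply]; exact hpp)]
      rw [hb]
      rfl
    rw [← hsub]
    refine sum_congr rfl fun p hp => ?_
    have hne : p.1 ≠ p.2 := (mem_offDiag.1 hp).2.2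
    have hb : complBits x (finProdFinEquiv p) = !x ⟨s(p.1, p.2), by simpa using hne⟩ := by
      unfold complBits
      rw [dif_neg (by rw [Equiv.symm_apply_apply]; exact hne)]
      simp only [Equiv.symm_apply_apply]
    rw [hb]
    have hiff : ((!x ⟨s(p.1, p.2), by simpa using hne⟩) = true) ↔
        ¬ ∃ h : p.1 ≠ p.2, x ⟨s(p.1, p.2), by simpa using h⟩ = true := by
      constructor
      · rintro h1 ⟨_, h2⟩
        have h3 : x ⟨s(p.1, p.2), by simpa using hne⟩ = true := h2
        rw [h3] at h1
        exact Bool.noConfusion h1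
      · intro h1
        cases hx : x ⟨s(p.1, p.2), by simpa using hne⟩
        · rfl
        · exact absurd ⟨hne, hx⟩ h1
    exact if_congr hiff rfl rfl
  have h2 := card_filter_add_card_filter_not
    (s := (univ : Finset (Fin n)).offDiag)
    (fun p : Fin n × Fin n => ∃ h : p.1 ≠ p.2, x ⟨s(p.1, p.2), by simpa using h⟩ = true)
  rw [card_offDiag_filter_eq_two_mul_edgeCount, offDiag_card, card_univ, Fintype.card_fin] at h2
  have h3 : n ≤ n * n := Nat.le_mul_self n
  omega

end Literature.Barriers.PneNP

end
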